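import Literature.Computability.Complexity.OrbitDeciders
import HarnessLib

/-!
# Oracle orbit deciders: orbits that query an orbit-decided language stay in `PSPACE`

Trunk toolkit on top of `OrbitDeciders.lean` (`OrbitDecider A`: an `FP` round function iterated
`2^{poly}` times on polynomially short states decides `A`, hence `A ∈ PSPACE` —
`OrbitDecider.mem_PSPACE`, the loop machine of `SpaceLoop.lean`; Arora–Barak 2009, Thm. 4.2 and
§4.1, "space can be reused"). This file adds the relativized shape and the nesting theorem:

* `oracleResolve B` — the query protocol. A state of an oracle orbit is a word `a q body`: head
  symbol `a` (the eventual answer bit, as for `OrbitDecider`), a QUERY FLAG `q`, and a body. When a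
  round of the `FP` step function `F` produces a flagged word `a 1 ⟨y, rest⟩`, the oracle replaces
  it by `a 0 ⟨[y ∈ B], rest⟩` before the next round (`oracleResolve`); unflagged words are kept.
* `OracleOrbitDecider B L` — an `FP` step `F`, an `FP` initialisation `ι`, an `FP` unary budget
  `Nu` and one polynomial `s` such that the RESOLVED orbit `(oracleResolve B ∘ F)^[k] (ι w)` and
  the words `F (…)` it produces stay of length `≤ s |w|`, `|Nu w| ≤ s |w|`, and after exactly
  `2^{|Nu w|}` resolved rounds the head symbol tells whether `w ∈ L`. This is the data of a
  polynomial-SPACE oracle machine asking polynomially SHORT queries to `B`, exponentially many of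
  them (the regime in which "`PSPACE^PSPACE = PSPACE`": queries are written on the work tape, so
  they are charged to the space bound).
* `OracleOrbitDecider.nest` (**the nesting theorem**): from an oracle orbit decider for `L`
  relative to `B` and a plain orbit decider for `B`, a plain orbit decider for `L` — the loop runs
  the outer step; on a flagged word it suspends the outer orbit, runs the orbit of `B` on the query
  for its `2^{|Nu_B y|}` rounds next to the suspended word (a binary round counter against the
  unary budget, as in `OrbitDecider.mem_PSPACE`), writes the answer bit into the word and resumes;
  an outer-round counter against `Nu w` freezes the state once `2^{|Nu w|}` outer rounds are
  simulated, so that the answer can be read at the fixed round `2^{|Nu w| + s_B(s(|w|)) + 2}`.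
  Corollary `OracleOrbitDecider.mem_PSPACE`: `L ∈ PSPACE`.

The consumer in view is the `PSPACE` simulation, relative to `TQBF`, of the quantum circuits of
Aaronson–Chen's Lemma 5.3 (`Literature/Barriers/QuantumAdvantage/AaronsonChenSimulation.lean`,
fact `aaronsonChen2017_lem53_machine`: "all the computations can be done in `PSPACE`, and
therefore can be implemented in `poly(n, 1/ε)` time with the help of the `TQBF` oracle"), whose
path sums evaluate `TQBF` at every oracle gate.

## Proof architecture

States of the nested loop are records `mkN a uN cO m st cI uI sI`: answer bit `a`, outer budget
`uN = Nu w`, outer round counter `cO` (canonical binary), mode `m` (`[0]` outer / `[1]` inner),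
outer word `st` (resolved orbit state, or the pending flagged word in inner mode), inner counter
`cI`, inner budget `uI = Nu_B y`, inner state `sI`. One round `roundN` is a four-way branch
(`doneT`: frozen; outer step `outerDone` / `enterInner`; inner step `innerStep` / `innerFinish`),
each branch a composition of bricks (`fanoutFn`, `nthF`, `iteFn`, `addFn`, `lenLeFn`,
`headBitFn`), so `roundN ∈ FP` is bookkeeping. The simulation is read off the macro states
`P w k` (after `k` outer rounds) and `I w k j` (`j` inner rounds into the query of outer round
`k`): `roundN_P_of_not_isQuery`, `roundN_P_of_isQuery`, `roundN_I_step`, `roundN_I_finish`,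
the timing `iterate_roundN_T` (outer round `k` costs `1` or `2^{|Nu_B y_k|} + 2` rounds,
`T_le`), the freeze `roundN_P_top`, and the invariant `Inv` bounding every state of the orbit.

## References

* S. Arora, B. Barak, *Computational Complexity: A Modern Approach*, CUP 2009, Thm. 4.2 and §4.1
  (space-bounded computation; reuse of space), §4.2 (`PSPACE`-completeness of `TQBF`), §3.4
  (oracle machines) [AroraBarakCC2009].
* S. Hirahara, Z. Lu, H. Ren, *Bounded relativization*, CCC 2023, Rem. 2 (p. 3): with queries
  counted in the space bound, `PSPACE^PSPACE = PSPACE` [HiraharaLuRen2023] — as cited in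
  `SpaceOracles.lean`.
* S. Aaronson, L. Chen, *Complexity-theoretic foundations of quantum supremacy experiments*,
  CCC 2017, §5.3 (p. 23) [AaronsonChen2017] (the consumer).
-/

noncomputable section

namespace Literature.Computability.Complexity

open _root_.Computability Polynomial Brick

attribute [-simp] Brick.nthF_zero Brick.sndPow_zero

/-! ### The query protocol -/

/-- **Resolving a query against the oracle `B`.** A flagged word `a 1 body`, `body = ⟨y, rest⟩`,
becomes `a 0 ⟨[y ∈ B], rest⟩` (the query `y` is replaced by its one-bit answer and the flag is
cleared); every other word is kept. [cite: AroraBarakCC2009, §3.4 (oracle machines: the query tape is replaced by the answer)] -/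
def oracleResolve (B : Language Bool) : List Bool → List Bool
  | a :: true :: body => a :: false :: boolPair [B.boolIndicator (fstF body)] (sndF body)
  | st => st

/-- A word is a query iff its second symbol is `1`. [folklore] -/
def IsQuery (st : List Bool) : Prop := st.tail.headI = true

/-- Being a query is decidable. [folklore] -/
instance (st : List Bool) : Decidable (IsQuery st) := inferInstanceAs (Decidable (_ = _))

/-- The query string of a word `a q ⟨y, rest⟩`: `y`. [folklore] -/
def qryOf (st : List Bool) : List Bool := fstF st.tail.tail

/-- Resolution of a flagged word. [folklore] -/
@[simp] theorem oracleResolve_cons_true (B : Language Bool) (a : Bool) (body : List Bool) :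
    oracleResolve B (a :: true :: body) = a :: false :: boolPair [B.boolIndicator (fstF body)] (sndF body) := rfl

/-- A query word has the shape `a 1 body`. [folklore] -/
theorem exists_eq_of_isQuery {st : List Bool} (h : IsQuery st) : ∃ (a : Bool) (body : List Bool), st = a :: true :: body := by
  rcases st with _ | ⟨a, _ | ⟨b, body⟩⟩
  · simp [IsQuery] at h
  · simp [IsQuery] at h
  · simp only [IsQuery, List.tail_cons, List.headI_cons] at h
    exact ⟨a, body, by rw [h]⟩

/-- Unflagged words are not changed by resolution. [folklore] -/
theorem oracleResolve_of_not_isQuery (B : Language Bool) {st : List Bool} (h : ¬ IsQuery st) :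
    oracleResolve B st = st := by
  rcases st with _ | ⟨a, _ | ⟨b, body⟩⟩
  · rfl
  · rfl
  · cases b
    · rfl
    · exact absurd rfl h

/-- Resolution keeps the head symbol. [folklore] -/
theorem headI_oracleResolve (B : Language Bool) (st : List Bool) : (oracleResolve B st).headI = st.headI := by
  by_cases h : IsQuery st
  · obtain ⟨a, body, rfl⟩ := exists_eq_of_isQuery h
    rfl
  · rw [oracleResolve_of_not_isQuery B h]

/-- The query string of a flagged word `a 1 body` is `fstF body`. [folklore] -/
@[simp] theorem qryOf_cons_cons (a b : Bool) (body : List Bool) : qryOf (a :: b :: body) = fstF body := rfl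

/-- The query string is not longer than the word. [folklore] -/
theorem length_qryOf_le (st : List Bool) : (qryOf st).length ≤ st.length := by
  have h1 := length_fstF_sndF_le st.tail.tail
  have h2 : st.tail.tail.length ≤ st.length := by simp [List.length_tail]; omega
  unfold qryOf
  omega

/-! ### Oracle orbit deciders -/

/-- **Oracle orbit decider** for `L` relative to the oracle `B`: an `FP` round function `F`, an
`FP` initial state `ι w`, an `FP` unary budget `Nu w` and one polynomial `s` such that the resolved
orbit `(oracleResolve B ∘ F)^[k] (ι w)` — each round applies `F` and has a flagged result answered
by `B` — consists of words of length `≤ s(|w|)`, as do the unresolved words `F (…)` (so queries are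
polynomially short), `|Nu w| ≤ s(|w|)`, and after exactly `2^{|Nu w|}` rounds the head symbol of
the state tells whether `w ∈ L`. A polynomial-space oracle machine with short queries, in the
orbit form of `OrbitDecider`. [cite: AroraBarakCC2009, Thm. 4.2, §4.1 and §3.4] [cite: HiraharaLuRen2023, Rem. 2 (p. 3)] -/
structure OracleOrbitDecider (B L : Language Bool) where
  /-- the round function -/
  F : List Bool → List Bool
  /-- … is polynomial-time -/
  F_mem : F ∈ FP
  /-- the initial state of an input -/
  ι : List Bool → List Bool
  /-- … is polynomial-time -/
  ι_mem : ι ∈ FP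
  /-- the unary budget: the orbit is read after `2 ^ |Nu w|` rounds -/
  Nu : List Bool → List Bool
  /-- … is polynomial-time -/
  Nu_mem : Nu ∈ FP
  /-- the space polynomial -/
  s : Polynomial ℕ
  /-- the budget is polynomial -/
  Nu_le : ∀ w, (Nu w).length ≤ s.eval w.length
  /-- every state of the resolved orbit is polynomially short -/
  size_le : ∀ w k, ((oracleResolve B ∘ F)^[k] (ι w)).length ≤ s.eval w.length
  /-- every word produced by a round (before resolution: it may carry a query) is polynomially short -/
  fsize_le : ∀ w k, (F ((oracleResolve B ∘ F)^[k] (ι w))).length ≤ s.eval w.length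
  /-- after `2 ^ |Nu w|` rounds the head symbol is the answer -/
  correct : ∀ w, ((oracleResolve B ∘ F)^[2 ^ (Nu w).length] (ι w)).headI = true ↔ w ∈ L

namespace OracleOrbitDecider

variable {B L : Language Bool} (E : OracleOrbitDecider B L) (D : OrbitDecider B)

/-- The resolved orbit of the input `w`. [folklore] -/
def orbit (w : List Bool) (k : ℕ) : List Bool := (oracleResolve B ∘ E.F)^[k] (E.ι w)

/-- The word produced in round `k + 1`, before resolution. [folklore] -/
def pre (w : List Bool) (k : ℕ) : List Bool := E.F (E.orbit w k)

/-- `orbit w 0 = ι w`. [folklore] -/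
@[simp] theorem orbit_zero (w : List Bool) : E.orbit w 0 = E.ι w := rfl

/-- `orbit w (k+1)` is the resolution of `pre w k`. [folklore] -/
theorem orbit_succ (w : List Bool) (k : ℕ) : E.orbit w (k + 1) = oracleResolve B (E.pre w k) := by
  rw [orbit, Function.iterate_succ_apply']; rfl

/-- The number of outer rounds to simulate: `K = 2^{|Nu w|}`. [folklore] -/
def K (w : List Bool) : ℕ := 2 ^ (E.Nu w).length

/-- The inner query of outer round `k + 1` (meaningful when `pre w k` is flagged). [folklore] -/
def qry (w : List Bool) (k : ℕ) : List Bool := qryOf (E.pre w k)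

/-- The polynomial bounding the inner budgets and states: `S' = s_B (s (|w|))`. [folklore] -/
def S' (w : List Bool) : ℕ := D.s.eval (E.s.eval w.length)

/-- Queries are polynomially short. [folklore] -/
theorem length_qry_le (w : List Bool) (k : ℕ) : (E.qry w k).length ≤ E.s.eval w.length :=
  (length_qryOf_le _).trans (E.fsize_le w k)

/-- Inner budgets are polynomially short: `|Nu_B (qry w k)| ≤ S'`. [folklore] -/
theorem length_Nu_qry_le (w : List Bool) (k : ℕ) : (D.Nu (E.qry w k)).length ≤ E.S' D w :=
  (D.Nu_le _).trans (TM2Iter.eval_mono D.s (E.length_qry_le w k))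

/-- Inner states are polynomially short. [folklore] -/
theorem length_inner_le (w : List Bool) (k j : ℕ) : (D.F^[j] (D.ι (E.qry w k))).length ≤ E.S' D w :=
  (D.size_le _ j).trans (TM2Iter.eval_mono D.s (E.length_qry_le w k))

/-! ### The nested loop: states and accessors -/

/-- The state record: answer bit, outer budget, outer counter, mode, outer word, inner counter,
inner budget, inner state. [cite: AroraBarakCC2009, §4.1 (reuse of space)] -/
def mkN (a : Bool) (uN cO m st cI uI sI : List Bool) : List Bool :=
  a :: boolPair uN (boolPair cO (boolPair m (boolPair st (boolPair cI (boolPair uI sI)))))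

/-- Length of a state record. [folklore] -/
theorem length_mkN (a : Bool) (uN cO m st cI uI sI : List Bool) :
    (mkN a uN cO m st cI uI sI).length =
      2 * uN.length + 2 * cO.length + 2 * m.length + 2 * st.length + 2 * cI.length + 2 * uI.length + sI.length + 13 := by
  simp only [mkN, length_boolPair, List.length_cons]
  ring

/-- Accessor: outer budget. [folklore] -/
def uNF : List Bool → List Bool := nthF 0 ∘ List.tail
/-- Accessor: outer counter. [folklore] -/
def cOF : List Bool → List Bool := nthF 1 ∘ List.tail
/-- Accessor: mode. [folklore] -/
def mF : List Bool → List Bool := nthF 2 ∘ List.tail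
/-- Accessor: outer word. [folklore] -/
def stF : List Bool → List Bool := nthF 3 ∘ List.tail
/-- Accessor: inner counter. [folklore] -/
def cIF : List Bool → List Bool := nthF 4 ∘ List.tail
/-- Accessor: inner budget. [folklore] -/
def uIF : List Bool → List Bool := nthF 5 ∘ List.tail
/-- Accessor: inner state. [folklore] -/
def sIF : List Bool → List Bool := sndPow 5 ∘ List.tail

section Accessors

variable (a : Bool) (uN cO m st cI uI sI : List Bool)

/-- `uNF` on a record. [folklore] -/
@[simp] theorem uNF_mkN : uNF (mkN a uN cO m st cI uI sI) = uN := by simp [uNF, mkN]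
/-- `cOF` on a record. [folklore] -/
@[simp] theorem cOF_mkN : cOF (mkN a uN cO m st cI uI sI) = cO := by simp [cOF, mkN]
/-- `mF` on a record. [folklore] -/
@[simp] theorem mF_mkN : mF (mkN a uN cO m st cI uI sI) = m := by simp [mF, mkN]
/-- `stF` on a record. [folklore] -/
@[simp] theorem stF_mkN : stF (mkN a uN cO m st cI uI sI) = st := by simp [stF, mkN]
/-- `cIF` on a record. [folklore] -/
@[simp] theorem cIF_mkN : cIF (mkN a uN cO m st cI uI sI) = cI := by simp [cIF, mkN]
/-- `uIF` on a record. [folklore] -/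
@[simp] theorem uIF_mkN : uIF (mkN a uN cO m st cI uI sI) = uI := by simp [uIF, mkN]
/-- `sIF` on a record. [folklore] -/
@[simp] theorem sIF_mkN : sIF (mkN a uN cO m st cI uI sI) = sI := by simp [sIF, mkN]
/-- The head symbol of a record. [folklore] -/
@[simp] theorem take1Fn_mkN : take1Fn (mkN a uN cO m st cI uI sI) = [a] := rfl
/-- The head symbol of a record. [folklore] -/
@[simp] theorem headI_mkN : (mkN a uN cO m st cI uI sI).headI = a := rfl

end Accessors

/-- The accessors are in `FP`. [folklore] -/
theorem uNF_mem_FP : uNF ∈ FP := comp_mem_FP (nthF_mem_FP 0) PRelSigma.tail_mem_FP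
/-- `cOF ∈ FP`. [folklore] -/
theorem cOF_mem_FP : cOF ∈ FP := comp_mem_FP (nthF_mem_FP 1) PRelSigma.tail_mem_FP
/-- `mF ∈ FP`. [folklore] -/
theorem mF_mem_FP : mF ∈ FP := comp_mem_FP (nthF_mem_FP 2) PRelSigma.tail_mem_FP
/-- `stF ∈ FP`. [folklore] -/
theorem stF_mem_FP : stF ∈ FP := comp_mem_FP (nthF_mem_FP 3) PRelSigma.tail_mem_FP
/-- `cIF ∈ FP`. [folklore] -/
theorem cIF_mem_FP : cIF ∈ FP := comp_mem_FP (nthF_mem_FP 4) PRelSigma.tail_mem_FP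
/-- `uIF ∈ FP`. [folklore] -/
theorem uIF_mem_FP : uIF ∈ FP := comp_mem_FP (nthF_mem_FP 5) PRelSigma.tail_mem_FP
/-- `sIF ∈ FP`. [folklore] -/
theorem sIF_mem_FP : sIF ∈ FP := comp_mem_FP (sndPow_mem_FP 5) PRelSigma.tail_mem_FP

/-- The body builder `⟨f₀ z, ⟨f₁ z, ⟨f₂ z, ⟨f₃ z, ⟨f₄ z, ⟨f₅ z, f₆ z⟩⟩⟩⟩⟩⟩`. [folklore] -/
def body7 (f₀ f₁ f₂ f₃ f₄ f₅ f₆ : List Bool → List Bool) : List Bool → List Bool :=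
  fanoutFn f₀ (fanoutFn f₁ (fanoutFn f₂ (fanoutFn f₃ (fanoutFn f₄ (fanoutFn f₅ f₆)))))

/-- `body7` evaluates fieldwise. [folklore] -/
@[simp] theorem body7_apply (f₀ f₁ f₂ f₃ f₄ f₅ f₆ : List Bool → List Bool) (z : List Bool) :
    body7 f₀ f₁ f₂ f₃ f₄ f₅ f₆ z =
      boolPair (f₀ z) (boolPair (f₁ z) (boolPair (f₂ z) (boolPair (f₃ z) (boolPair (f₄ z) (boolPair (f₅ z) (f₆ z)))))) := by
  simp [body7]

/-- `body7` of `FP` functions is in `FP`. [folklore] -/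
theorem body7_mem_FP {f₀ f₁ f₂ f₃ f₄ f₅ f₆ : List Bool → List Bool} (h₀ : f₀ ∈ FP) (h₁ : f₁ ∈ FP)
    (h₂ : f₂ ∈ FP) (h₃ : f₃ ∈ FP) (h₄ : f₄ ∈ FP) (h₅ : f₅ ∈ FP) (h₆ : f₆ ∈ FP) :
    body7 f₀ f₁ f₂ f₃ f₄ f₅ f₆ ∈ FP :=
  fanoutFn_mem_FP h₀ (fanoutFn_mem_FP h₁ (fanoutFn_mem_FP h₂ (fanoutFn_mem_FP h₃
    (fanoutFn_mem_FP h₄ (fanoutFn_mem_FP h₅ h₆)))))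

/-- A head symbol followed by a body is a record. [folklore] -/
theorem cons_body7 (a : Bool) (uN cO m st cI uI sI : List Bool) :
    [a] ++ boolPair uN (boolPair cO (boolPair m (boolPair st (boolPair cI (boolPair uI sI))))) =
      mkN a uN cO m st cI uI sI := rfl

/-! ### The nested loop: tests and branches -/

/-- Frozen? `[|uN| < |cO|]`, i.e. `2^{|uN|} ≤ ⟦cO⟧` for a canonical counter. [folklore] -/
def doneT : List Bool → List Bool := notFn (lenLeFn X ∘ fanoutFn uNF cOF)

/-- The outer step applied to the outer word. [folklore] -/
def st1F : List Bool → List Bool := E.F ∘ stF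

/-- Is the outer step's result a query? (its second symbol). [folklore] -/
def qryT : List Bool → List Bool := OrbitDecider.headBitFn (List.tail ∘ E.st1F)

/-- The query string of the outer step's result. [folklore] -/
def qF : List Bool → List Bool := fstF ∘ List.tail ∘ List.tail ∘ E.st1F

/-- Inner orbit finished? `[|uI| < |cI|]`. [folklore] -/
def innerDoneT : List Bool → List Bool := notFn (lenLeFn X ∘ fanoutFn uIF cIF)

/-- The incremented outer counter. [folklore] -/
def succCO : List Bool → List Bool := addFn ∘ fanoutFn cOF (fun _ => [true])

/-- The incremented inner counter. [folklore] -/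
def succCI : List Bool → List Bool := addFn ∘ fanoutFn cIF (fun _ => [true])

/-- Branch: the outer step produced a query — suspend it and start the inner orbit on the query.
[cite: AroraBarakCC2009, §4.1] -/
def enterInner : List Bool → List Bool := fun z =>
  take1Fn z ++ body7 uNF cOF (fun _ => [true]) E.st1F (fun _ => []) (D.Nu ∘ E.qF) (D.ι ∘ E.qF) z

/-- Branch: the outer step produced no query — commit it and count the round. [cite: AroraBarakCC2009, §4.1] -/
def outerDone : List Bool → List Bool := fun z =>
  OrbitDecider.headBitFn E.st1F z ++ body7 uNF succCO (fun _ => [false]) E.st1F (fun _ => []) (fun _ => []) (fun _ => []) z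

/-- Branch: one more round of the inner orbit. [cite: AroraBarakCC2009, §4.1] -/
def innerStep (D : OrbitDecider B) : List Bool → List Bool := fun z =>
  take1Fn z ++ body7 uNF cOF (fun _ => [true]) stF succCI uIF (D.F ∘ sIF) z

/-- The suspended word with its query replaced by the inner orbit's answer bit (the machine's
rendering of `oracleResolve`). [cite: AroraBarakCC2009, §3.4] -/
def st2F : List Bool → List Bool := fun z =>
  (take1Fn ∘ stF) z ++ (List.cons false ∘ fanoutFn (OrbitDecider.headBitFn sIF) (sndF ∘ List.tail ∘ List.tail ∘ stF)) z

/-- Branch: the inner orbit is finished — resolve the suspended word, resume, count the round.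
[cite: AroraBarakCC2009, §4.1] -/
def innerFinish : List Bool → List Bool := fun z =>
  OrbitDecider.headBitFn st2F z ++ body7 uNF succCO (fun _ => [false]) st2F (fun _ => []) (fun _ => []) (fun _ => []) z

/-- **One round of the nested loop.** [cite: AroraBarakCC2009, Thm. 4.2 and §4.1] -/
def roundN : List Bool → List Bool :=
  iteFn doneT id (iteFn mF (iteFn innerDoneT innerFinish (innerStep D)) (iteFn E.qryT (E.enterInner D) E.outerDone))

/-- **The initial state** `mkN (head (ι w)) (Nu w) 0 [0] (ι w) ε ε ε`. [folklore] -/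
def initN : List Bool → List Bool := fun w =>
  OrbitDecider.headBitFn E.ι w ++ body7 E.Nu (fun _ => []) (fun _ => [false]) E.ι (fun _ => []) (fun _ => []) (fun _ => []) w

/-- **The unary budget** `Nu w ++ 1^{S' + 2}`: `2^{|Nu w| + S' + 2}` rounds suffice for `2^{|Nu w|}`
outer rounds of cost `≤ 2^{S'} + 2` each. [folklore] -/
def NuN : List Bool → List Bool := fun w => E.Nu w ++ Plumb.polyFn (D.s.comp E.s + 2) w

/-! ### `FP` bookkeeping -/

/-- `doneT ∈ FP`. [folklore] -/
theorem doneT_mem_FP : doneT ∈ FP :=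
  notFn_mem_FP (comp_mem_FP (lenLeFn_mem_FP X) (fanoutFn_mem_FP uNF_mem_FP cOF_mem_FP))

/-- `st1F ∈ FP`. [folklore] -/
theorem st1F_mem_FP : E.st1F ∈ FP := comp_mem_FP E.F_mem stF_mem_FP

/-- `qryT ∈ FP`. [folklore] -/
theorem qryT_mem_FP : E.qryT ∈ FP :=
  OrbitDecider.headBitFn_mem_FP (comp_mem_FP PRelSigma.tail_mem_FP E.st1F_mem_FP)

/-- `qF ∈ FP`. [folklore] -/
theorem qF_mem_FP : E.qF ∈ FP :=
  comp_mem_FP fstF_mem_FP (comp_mem_FP PRelSigma.tail_mem_FP (comp_mem_FP PRelSigma.tail_mem_FP E.st1F_mem_FP))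

/-- `innerDoneT ∈ FP`. [folklore] -/
theorem innerDoneT_mem_FP : innerDoneT ∈ FP :=
  notFn_mem_FP (comp_mem_FP (lenLeFn_mem_FP X) (fanoutFn_mem_FP uIF_mem_FP cIF_mem_FP))

/-- `succCO ∈ FP`. [folklore] -/
theorem succCO_mem_FP : succCO ∈ FP :=
  comp_mem_FP addFn_mem_FP (fanoutFn_mem_FP cOF_mem_FP (const_mem_FP _))

/-- `succCI ∈ FP`. [folklore] -/
theorem succCI_mem_FP : succCI ∈ FP :=
  comp_mem_FP addFn_mem_FP (fanoutFn_mem_FP cIF_mem_FP (const_mem_FP _))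

/-- `enterInner ∈ FP`. [folklore] -/
theorem enterInner_mem_FP : E.enterInner D ∈ FP :=
  append_mem_FP take1Fn_mem_FP (body7_mem_FP uNF_mem_FP cOF_mem_FP (const_mem_FP _) E.st1F_mem_FP
    (const_mem_FP _) (comp_mem_FP D.Nu_mem E.qF_mem_FP) (comp_mem_FP D.ι_mem E.qF_mem_FP))

/-- `outerDone ∈ FP`. [folklore] -/
theorem outerDone_mem_FP : E.outerDone ∈ FP :=
  append_mem_FP (OrbitDecider.headBitFn_mem_FP E.st1F_mem_FP) (body7_mem_FP uNF_mem_FP succCO_mem_FP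
    (const_mem_FP _) E.st1F_mem_FP (const_mem_FP _) (const_mem_FP _) (const_mem_FP _))

/-- `innerStep ∈ FP`. [folklore] -/
theorem innerStep_mem_FP : innerStep D ∈ FP :=
  append_mem_FP take1Fn_mem_FP (body7_mem_FP uNF_mem_FP cOF_mem_FP (const_mem_FP _) stF_mem_FP
    succCI_mem_FP uIF_mem_FP (comp_mem_FP D.F_mem sIF_mem_FP))

/-- `st2F ∈ FP`. [folklore] -/
theorem st2F_mem_FP : st2F ∈ FP :=
  append_mem_FP (comp_mem_FP take1Fn_mem_FP stF_mem_FP)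
    (comp_mem_FP (cons_mem_FP false) (fanoutFn_mem_FP (OrbitDecider.headBitFn_mem_FP sIF_mem_FP)
      (comp_mem_FP sndF_mem_FP (comp_mem_FP PRelSigma.tail_mem_FP (comp_mem_FP PRelSigma.tail_mem_FP stF_mem_FP)))))

/-- `innerFinish ∈ FP`. [folklore] -/
theorem innerFinish_mem_FP : innerFinish ∈ FP :=
  append_mem_FP (OrbitDecider.headBitFn_mem_FP st2F_mem_FP) (body7_mem_FP uNF_mem_FP succCO_mem_FP
    (const_mem_FP _) st2F_mem_FP (const_mem_FP _) (const_mem_FP _) (const_mem_FP _))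

/-- **`roundN ∈ FP`.** [cite: AroraBarakCC2009, §1.3 (closure under composition)] -/
theorem roundN_mem_FP : E.roundN D ∈ FP :=
  iteFn_mem_FP doneT_mem_FP OracleCompose.id_mem_FP
    (iteFn_mem_FP mF_mem_FP (iteFn_mem_FP innerDoneT_mem_FP innerFinish_mem_FP (innerStep_mem_FP D))
      (iteFn_mem_FP E.qryT_mem_FP (E.enterInner_mem_FP D) E.outerDone_mem_FP))

/-- `initN ∈ FP`. [folklore] -/
theorem initN_mem_FP : E.initN ∈ FP :=
  append_mem_FP (OrbitDecider.headBitFn_mem_FP E.ι_mem) (body7_mem_FP E.Nu_mem (const_mem_FP _)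
    (const_mem_FP _) E.ι_mem (const_mem_FP _) (const_mem_FP _) (const_mem_FP _))

/-- `NuN ∈ FP`. [folklore] -/
theorem NuN_mem_FP : E.NuN D ∈ FP := append_mem_FP E.Nu_mem (Plumb.polyFn_mem_FP _)

/-- Length of the budget: `|NuN w| = |Nu w| + S' + 2`. [folklore] -/
theorem length_NuN (w : List Bool) : (E.NuN D w).length = (E.Nu w).length + E.S' D w + 2 := by
  simp [NuN, S', eval_comp, Nat.add_assoc]

/-! ### Semantics of the tests and branches on records -/

section Semantics

variable (a : Bool) (uN cO m st cI uI sI : List Bool)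

/-- `doneT` on a record. [folklore] -/
theorem doneT_mkN : doneT (mkN a uN cO m st cI uI sI) = [decide (uN.length < cO.length)] := by
  have h : (lenLeFn X ∘ fanoutFn uNF cOF) (mkN a uN cO m st cI uI sI) = [decide (cO.length ≤ uN.length)] := by
    simp [lenLeFn_boolPair]
  rw [doneT, notFn_apply h]
  by_cases hc : cO.length ≤ uN.length
  · rw [decide_eq_true hc, decide_eq_false (Nat.not_lt.2 hc)]; rfl
  · rw [decide_eq_false hc, decide_eq_true (Nat.lt_of_not_le hc)]; rfl

/-- `innerDoneT` on a record. [folklore] -/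
theorem innerDoneT_mkN : innerDoneT (mkN a uN cO m st cI uI sI) = [decide (uI.length < cI.length)] := by
  have h : (lenLeFn X ∘ fanoutFn uIF cIF) (mkN a uN cO m st cI uI sI) = [decide (cI.length ≤ uI.length)] := by
    simp [lenLeFn_boolPair]
  rw [innerDoneT, notFn_apply h]
  by_cases hc : cI.length ≤ uI.length
  · rw [decide_eq_true hc, decide_eq_false (Nat.not_lt.2 hc)]; rfl
  · rw [decide_eq_false hc, decide_eq_true (Nat.lt_of_not_le hc)]; rfl

/-- `st1F` on a record. [folklore] -/
@[simp] theorem st1F_mkN : E.st1F (mkN a uN cO m st cI uI sI) = E.F st := by simp [st1F]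

/-- `qryT` on a record. [folklore] -/
theorem qryT_mkN : E.qryT (mkN a uN cO m st cI uI sI) = [(E.F st).tail.headI] := by
  rw [qryT, OrbitDecider.headBitFn_apply, Function.comp_apply, st1F_mkN]

/-- `qF` on a record. [folklore] -/
@[simp] theorem qF_mkN : E.qF (mkN a uN cO m st cI uI sI) = qryOf (E.F st) := by
  simp [qF, qryOf, st1F]

/-- `succCO` on a record. [folklore] -/
@[simp] theorem succCO_mkN : succCO (mkN a uN cO m st cI uI sI) = encodeNat (bitsToNat cO + 1) := by
  simp [succCO]

/-- `succCI` on a record. [folklore] -/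
@[simp] theorem succCI_mkN : succCI (mkN a uN cO m st cI uI sI) = encodeNat (bitsToNat cI + 1) := by
  simp [succCI]

/-- `enterInner` on a record. [folklore] -/
theorem enterInner_mkN : E.enterInner D (mkN a uN cO m st cI uI sI) =
    mkN a uN cO [true] (E.F st) [] (D.Nu (qryOf (E.F st))) (D.ι (qryOf (E.F st))) := by
  rw [enterInner, body7_apply, take1Fn_mkN]
  simp only [uNF_mkN, cOF_mkN, st1F_mkN, Function.comp_apply, qF_mkN]
  rfl

/-- `outerDone` on a record. [folklore] -/
theorem outerDone_mkN : E.outerDone (mkN a uN cO m st cI uI sI) =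
    mkN (E.F st).headI uN (encodeNat (bitsToNat cO + 1)) [false] (E.F st) [] [] [] := by
  rw [outerDone, body7_apply, OrbitDecider.headBitFn_apply]
  simp only [uNF_mkN, succCO_mkN, st1F_mkN]
  rfl

/-- `innerStep` on a record. [folklore] -/
theorem innerStep_mkN : innerStep D (mkN a uN cO m st cI uI sI) =
    mkN a uN cO [true] st (encodeNat (bitsToNat cI + 1)) uI (D.F sI) := by
  rw [innerStep, body7_apply, take1Fn_mkN]
  simp only [uNF_mkN, cOF_mkN, stF_mkN, succCI_mkN, uIF_mkN, Function.comp_apply, sIF_mkN]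
  rfl

/-- `st2F` on a record whose outer word is flagged: the resolution with the inner head bit as the
answer. [folklore] -/
theorem st2F_mkN (a' : Bool) (body : List Bool) :
    st2F (mkN a uN cO m (a' :: true :: body) cI uI sI) = a' :: false :: boolPair [sI.headI] (sndF body) := by
  rw [st2F]
  simp only [Function.comp_apply, stF_mkN, fanoutFn_apply, OrbitDecider.headBitFn_apply, sIF_mkN,
    List.tail_cons]
  rfl

/-- `innerFinish` on a record whose outer word is flagged. [folklore] -/
theorem innerFinish_mkN (a' : Bool) (body : List Bool) :
    innerFinish (mkN a uN cO m (a' :: true :: body) cI uI sI) =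
      mkN a' uN (encodeNat (bitsToNat cO + 1)) [false] (a' :: false :: boolPair [sI.headI] (sndF body)) [] [] [] := by
  rw [innerFinish, body7_apply, OrbitDecider.headBitFn_apply, st2F_mkN]
  simp only [uNF_mkN, succCO_mkN]
  rfl

/-- A frozen record is fixed by the round. [folklore] -/
theorem roundN_of_done (h : uN.length < cO.length) : E.roundN D (mkN a uN cO m st cI uI sI) = mkN a uN cO m st cI uI sI := by
  rw [roundN, iteFn_apply_true (by rw [doneT_mkN, decide_eq_true h])]
  rfl

end Semantics

/-! ### Macro states and the simulation -/

/-- **The macro state after `k` outer rounds**: answer bit and word of the resolved orbit, counter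
`k`, outer mode, inner fields cleared. [cite: AroraBarakCC2009, §4.1] -/
def P (w : List Bool) (k : ℕ) : List Bool :=
  mkN (E.orbit w k).headI (E.Nu w) (encodeNat k) [false] (E.orbit w k) [] [] []

/-- **The intermediate state** `j` inner rounds into the query of outer round `k + 1`: the flagged
word `pre w k` is suspended, the inner orbit of `B` on its query has run `j` rounds.
[cite: AroraBarakCC2009, §4.1] -/
def I (w : List Bool) (k j : ℕ) : List Bool :=
  mkN (E.orbit w k).headI (E.Nu w) (encodeNat k) [true] (E.pre w k) (encodeNat j) (D.Nu (E.qry w k))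
    (D.F^[j] (D.ι (E.qry w k)))

/-- The initial state is the macro state `P w 0`. [folklore] -/
theorem initN_eq (w : List Bool) : E.initN w = E.P w 0 := by
  rw [initN, body7_apply, OrbitDecider.headBitFn_apply]
  rfl

/-- Before `K` outer rounds the outer counter has not overflowed. [folklore] -/
theorem not_done_of_lt {w : List Bool} {k : ℕ} (hk : k < E.K w) : ¬ (E.Nu w).length < (encodeNat k).length := by
  rw [OrbitDecider.lt_length_encodeNat_iff]
  exact Nat.not_le.2 hk

/-- **An outer round without a query costs one round**: `P w k ↦ P w (k+1)`. [cite: AroraBarakCC2009, §4.1] -/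
theorem roundN_P_of_not_isQuery {w : List Bool} {k : ℕ} (hk : k < E.K w) (hq : ¬ IsQuery (E.pre w k)) :
    E.roundN D (E.P w k) = E.P w (k + 1) := by
  rw [P, roundN, iteFn_apply_false (by rw [doneT_mkN, decide_eq_false (E.not_done_of_lt hk)]),
    iteFn_apply_false (mF_mkN _ _ _ _ _ _ _ _),
    iteFn_apply_false (by rw [qryT_mkN]; exact congrArg (fun b => [b]) (eq_false_of_ne_true hq)),
    outerDone_mkN, bitsToNat_encodeNat, P, E.orbit_succ w k]
  change mkN (E.pre w k).headI _ _ _ (E.pre w k) _ _ _ = _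
  rw [oracleResolve_of_not_isQuery B hq]

/-- **An outer round with a query first suspends the word**: `P w k ↦ I w k 0`. [cite: AroraBarakCC2009, §4.1] -/
theorem roundN_P_of_isQuery {w : List Bool} {k : ℕ} (hk : k < E.K w) (hq : IsQuery (E.pre w k)) :
    E.roundN D (E.P w k) = E.I D w k 0 := by
  rw [P, roundN, iteFn_apply_false (by rw [doneT_mkN, decide_eq_false (E.not_done_of_lt hk)]),
    iteFn_apply_false (mF_mkN _ _ _ _ _ _ _ _),
    iteFn_apply_true (by rw [qryT_mkN]; exact congrArg (fun b => [b]) hq),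
    enterInner_mkN, I, qry]
  rfl

/-- **An inner round**: `I w k j ↦ I w k (j+1)` while `j < 2^{|Nu_B y|}`. [cite: AroraBarakCC2009, §4.1] -/
theorem roundN_I_step {w : List Bool} {k j : ℕ} (hk : k < E.K w) (hj : j < 2 ^ (D.Nu (E.qry w k)).length) :
    E.roundN D (E.I D w k j) = E.I D w k (j + 1) := by
  have hj' : ¬ (D.Nu (E.qry w k)).length < (encodeNat j).length := by
    rw [OrbitDecider.lt_length_encodeNat_iff]; exact Nat.not_le.2 hj
  rw [I, roundN, iteFn_apply_false (by rw [doneT_mkN, decide_eq_false (E.not_done_of_lt hk)]),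
    iteFn_apply_true (mF_mkN _ _ _ _ _ _ _ _),
    iteFn_apply_false (by rw [innerDoneT_mkN, decide_eq_false hj']),
    innerStep_mkN, bitsToNat_encodeNat, I, Function.iterate_succ_apply']

/-- The inner orbit's final head bit is the oracle's answer bit. [folklore] -/
theorem headI_inner_eq (y : List Bool) : (D.F^[2 ^ (D.Nu y).length] (D.ι y)).headI = B.boolIndicator y := by
  rcases Bool.eq_false_or_eq_true (B.boolIndicator y) with h | h
  · rw [h]; exact (D.correct y).2 ((Set.mem_iff_boolIndicator _ _).2 h)
  · rw [h]
    cases hb : (D.F^[2 ^ (D.Nu y).length] (D.ι y)).headI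
    · rfl
    · exact absurd ((Set.mem_iff_boolIndicator _ _).1 ((D.correct y).1 hb)) (by rw [h]; simp)

/-- **Finishing the inner orbit resolves the word**: `I w k 2^{|Nu_B y|} ↦ P w (k+1)`.
[cite: AroraBarakCC2009, §4.1 and §3.4] -/
theorem roundN_I_finish {w : List Bool} {k : ℕ} (hk : k < E.K w) (hq : IsQuery (E.pre w k)) :
    E.roundN D (E.I D w k (2 ^ (D.Nu (E.qry w k)).length)) = E.P w (k + 1) := by
  obtain ⟨a', body, hpre⟩ := exists_eq_of_isQuery hq
  have hdone : (D.Nu (E.qry w k)).length < (encodeNat (2 ^ (D.Nu (E.qry w k)).length)).length := by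
    rw [OrbitDecider.lt_length_encodeNat_iff]
  have hqry : E.qry w k = fstF body := by rw [qry, hpre]; rfl
  rw [I, roundN, iteFn_apply_false (by rw [doneT_mkN, decide_eq_false (E.not_done_of_lt hk)]),
    iteFn_apply_true (mF_mkN _ _ _ _ _ _ _ _),
    iteFn_apply_true (by rw [innerDoneT_mkN, decide_eq_true hdone])]
  rw [hpre, innerFinish_mkN, bitsToNat_encodeNat, headI_inner_eq, P, E.orbit_succ w k, hpre,
    oracleResolve_cons_true, hqry]
  rfl

/-- The inner orbit runs undisturbed: `roundN^[j] (I w k 0) = I w k j` for `j ≤ 2^{|Nu_B y|}`. [folklore] -/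
theorem iterate_roundN_I {w : List Bool} {k : ℕ} (hk : k < E.K w) :
    ∀ {j : ℕ}, j ≤ 2 ^ (D.Nu (E.qry w k)).length → (E.roundN D)^[j] (E.I D w k 0) = E.I D w k j
  | 0, _ => rfl
  | j + 1, hj => by
    rw [Function.iterate_succ_apply', iterate_roundN_I hk (Nat.le_of_succ_le hj), E.roundN_I_step D hk hj]

/-- **A query round costs `2^{|Nu_B y|} + 2` rounds**: `P w k ↦ P w (k+1)`. [cite: AroraBarakCC2009, §4.1] -/
theorem iterate_roundN_P_of_isQuery {w : List Bool} {k : ℕ} (hk : k < E.K w) (hq : IsQuery (E.pre w k)) :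
    (E.roundN D)^[2 ^ (D.Nu (E.qry w k)).length + 2] (E.P w k) = E.P w (k + 1) := by
  rw [show 2 ^ (D.Nu (E.qry w k)).length + 2 = (1 + 2 ^ (D.Nu (E.qry w k)).length) + 1 by ring,
    Function.iterate_add_apply, Function.iterate_add_apply, Function.iterate_one,
    E.roundN_P_of_isQuery D hk hq, E.iterate_roundN_I D hk le_rfl, E.roundN_I_finish D hk hq]

/-- The cost of outer round `k + 1` in rounds of the nested loop. [folklore] -/
def cost (w : List Bool) (k : ℕ) : ℕ := if IsQuery (E.pre w k) then 2 ^ (D.Nu (E.qry w k)).length + 2 else 1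

/-- The round of the nested loop at which `k` outer rounds are complete. [folklore] -/
def T (w : List Bool) : ℕ → ℕ
  | 0 => 0
  | k + 1 => T w k + E.cost D w k

/-- **Timing of the simulation**: after `T w k` rounds the loop is in the macro state `P w k`
(`k ≤ K`). [cite: AroraBarakCC2009, §4.1] -/
theorem iterate_roundN_T (w : List Bool) : ∀ {k : ℕ}, k ≤ E.K w → (E.roundN D)^[E.T D w k] (E.P w 0) = E.P w k
  | 0, _ => rfl
  | k + 1, hk => by
    have hk' : k < E.K w := hk
    rw [T, Nat.add_comm, Function.iterate_add_apply, iterate_roundN_T w hk'.le, cost]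
    split_ifs with hq
    · exact E.iterate_roundN_P_of_isQuery D hk' hq
    · rw [Function.iterate_one, E.roundN_P_of_not_isQuery D hk' hq]

/-- Each outer round costs at most `2^{S'} + 2` rounds. [folklore] -/
theorem cost_le (w : List Bool) (k : ℕ) : E.cost D w k ≤ 2 ^ E.S' D w + 2 := by
  unfold cost
  split_ifs
  · exact Nat.add_le_add_right (Nat.pow_le_pow_right (by norm_num) (E.length_Nu_qry_le D w k)) 2
  · have := Nat.one_le_two_pow (n := E.S' D w); omega

/-- Hence `T w k ≤ k (2^{S'} + 2)`. [folklore] -/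
theorem T_le (w : List Bool) : ∀ k, E.T D w k ≤ k * (2 ^ E.S' D w + 2)
  | 0 => by simp [T]
  | k + 1 => by
    rw [T, Nat.succ_mul]
    exact Nat.add_le_add (T_le w k) (E.cost_le D w k)

/-- The whole simulation fits in the budget: `T w K ≤ 2^{|NuN w|}`. [folklore] -/
theorem T_K_le (w : List Bool) : E.T D w (E.K w) ≤ 2 ^ (E.NuN D w).length := by
  refine (E.T_le D w _).trans ?_
  have h4 : 2 ^ E.S' D w + 2 ≤ 2 ^ (E.S' D w + 2) := by
    have := Nat.one_le_two_pow (n := E.S' D w)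
    rw [Nat.pow_add]
    omega
  rw [length_NuN, K, Nat.add_assoc, Nat.pow_add _ (E.Nu w).length]
  exact Nat.mul_le_mul_left _ h4

/-- **The frozen state**: once `K` outer rounds are simulated the loop idles. [folklore] -/
theorem roundN_P_top (w : List Bool) : E.roundN D (E.P w (E.K w)) = E.P w (E.K w) :=
  E.roundN_of_done D _ _ _ _ _ _ _ _ (by rw [OrbitDecider.lt_length_encodeNat_iff]; rfl)

/-- After the budget the loop sits in the final macro state. [folklore] -/
theorem iterate_roundN_budget (w : List Bool) :
    (E.roundN D)^[2 ^ (E.NuN D w).length] (E.initN w) = E.P w (E.K w) := by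
  obtain ⟨d, hd⟩ := Nat.exists_eq_add_of_le (E.T_K_le D w)
  rw [hd, Nat.add_comm, Function.iterate_add_apply, initN_eq, E.iterate_roundN_T D w le_rfl]
  exact Function.iterate_fixed (E.roundN_P_top D w) d

/-! ### The invariant: every state of the nested orbit is a macro or an intermediate state -/

/-- The states met by the nested loop. [folklore] -/
def Inv (w z : List Bool) : Prop :=
  (∃ k, k ≤ E.K w ∧ z = E.P w k) ∨
    (∃ k j, k < E.K w ∧ IsQuery (E.pre w k) ∧ j ≤ 2 ^ (D.Nu (E.qry w k)).length ∧ z = E.I D w k j)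

/-- The invariant holds initially. [folklore] -/
theorem inv_init (w : List Bool) : E.Inv D w (E.initN w) :=
  Or.inl ⟨0, Nat.zero_le _, E.initN_eq w⟩

/-- The invariant is preserved by a round. [folklore] -/
theorem inv_round {w z : List Bool} (h : E.Inv D w z) : E.Inv D w (E.roundN D z) := by
  rcases h with ⟨k, hk, rfl⟩ | ⟨k, j, hk, hq, hj, rfl⟩
  · rcases hk.lt_or_eq with hk | rfl
    · by_cases hq : IsQuery (E.pre w k)
      · rw [E.roundN_P_of_isQuery D hk hq]
        exact Or.inr ⟨k, 0, hk, hq, Nat.zero_le _, rfl⟩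
      · rw [E.roundN_P_of_not_isQuery D hk hq]
        exact Or.inl ⟨k + 1, hk, rfl⟩
    · rw [E.roundN_P_top D w]
      exact Or.inl ⟨E.K w, le_rfl, rfl⟩
  · rcases hj.lt_or_eq with hj | rfl
    · rw [E.roundN_I_step D hk hj]
      exact Or.inr ⟨k, j + 1, hk, hq, hj, rfl⟩
    · rw [E.roundN_I_finish D hk hq]
      exact Or.inl ⟨k + 1, hk, rfl⟩

/-- Every state of the nested orbit satisfies the invariant. [folklore] -/
theorem inv_iterate (w : List Bool) (n : ℕ) : E.Inv D w ((E.roundN D)^[n] (E.initN w)) := by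
  induction n with
  | zero => exact E.inv_init D w
  | succ n ih => rw [Function.iterate_succ_apply']; exact E.inv_round D ih

/-- A counter below `2^m` (inclusive) has at most `m + 1` bits. [folklore] -/
theorem length_encodeNat_le_of_le {k m : ℕ} (hk : k ≤ 2 ^ m) : (encodeNat k).length ≤ m + 1 := by
  rw [TM2Pass.length_encodeNat_eq_size, Nat.size_le]
  exact lt_of_le_of_lt hk (Nat.pow_lt_pow_right (by norm_num) (Nat.lt_succ_self m))

/-- **The space polynomial of the nested loop.** [folklore] -/
def sN : Polynomial ℕ := 6 * E.s + 5 * D.s.comp E.s + 24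

/-- States satisfying the invariant are polynomially short. [folklore] -/
theorem length_le_of_inv {w z : List Bool} (h : E.Inv D w z) : z.length ≤ (E.sN D).eval w.length := by
  have hNu := E.Nu_le w
  have hsN : (E.sN D).eval w.length = 6 * E.s.eval w.length + 5 * E.S' D w + 24 := by
    simp [sN, S', eval_comp]
  rw [hsN]
  rcases h with ⟨k, hk, rfl⟩ | ⟨k, j, hk, -, hj, rfl⟩
  · rw [P, length_mkN]
    have h1 : (E.orbit w k).length ≤ E.s.eval w.length := E.size_le w k
    have h2 : (encodeNat k).length ≤ (E.Nu w).length + 1 := length_encodeNat_le_of_le hk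
    simp only [List.length_cons, List.length_nil]
    omega
  · rw [I, length_mkN]
    have h1 : (E.pre w k).length ≤ E.s.eval w.length := E.fsize_le w k
    have h2 : (encodeNat k).length ≤ (E.Nu w).length + 1 := length_encodeNat_le_of_le hk.le
    have h3 : (encodeNat j).length ≤ E.S' D w + 1 :=
      (length_encodeNat_le_of_le hj).trans (Nat.succ_le_succ (E.length_Nu_qry_le D w k))
    have h4 := E.length_Nu_qry_le D w k
    have h5 := E.length_inner_le D w k j
    simp only [List.length_cons, List.length_nil]
    omega

/-! ### The nesting theorem -/

/-- **Nesting**: an oracle orbit decider for `L` relative to `B` and an orbit decider for `B` give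
an orbit decider for `L` (round function `roundN`, initial state `initN`, budget `NuN`, space
`sN`). The polynomial-space oracle machine is run with every query answered by an in-place run of
the polynomial-space machine for `B` — the argument behind "`PSPACE^PSPACE = PSPACE`" for
polynomially short queries. [cite: AroraBarakCC2009, Thm. 4.2 and §4.1 (reuse of space)] [cite: HiraharaLuRen2023, Rem. 2 (p. 3)] -/
def nest : OrbitDecider L where
  F := E.roundN D
  F_mem := E.roundN_mem_FP D
  ι := E.initN
  ι_mem := E.initN_mem_FP
  Nu := E.NuN D
  Nu_mem := E.NuN_mem_FP D
  s := E.sN D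
  Nu_le w := by
    rw [length_NuN]
    have := E.Nu_le w
    simp [sN, S', eval_comp]
    omega
  size_le w k := E.length_le_of_inv D (E.inv_iterate D w k)
  correct w := by
    rw [E.iterate_roundN_budget D w, P, headI_mkN]
    exact E.correct w

end OracleOrbitDecider

/-- **A language with an oracle orbit decider relative to an orbit-decided oracle is in `PSPACE`.**
[cite: AroraBarakCC2009, Thm. 4.2 and §4.1] [cite: HiraharaLuRen2023, Rem. 2 (p. 3)] -/
theorem OracleOrbitDecider.mem_PSPACE {B L : Language Bool} (E : OracleOrbitDecider B L) (D : OrbitDecider B) :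
    L ∈ PSPACE :=
  (E.nest D).mem_PSPACE

/-- **Restatement with the structures as hypotheses**: `L ∈ PSPACE` whenever `L` has an oracle
orbit decider relative to some `B` that has an orbit decider. [cite: AroraBarakCC2009, Thm. 4.2 and §4.1] -/
theorem mem_PSPACE_of_oracleOrbitDecider {B L : Language Bool} (E : OracleOrbitDecider B L)
    (D : OrbitDecider B) : L ∈ PSPACE :=
  E.mem_PSPACE D

/-- An orbit decider whose words are never flagged is an oracle orbit decider relative to any
oracle (no query is ever asked). [folklore] -/
def OrbitDecider.toOracle {L : Language Bool} (D : OrbitDecider L) (B : Language Bool)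
    (hq : ∀ w k, ¬ IsQuery (D.F (D.F^[k] (D.ι w)))) : OracleOrbitDecider B L :=
  have horb : ∀ w k, (oracleResolve B ∘ D.F)^[k] (D.ι w) = D.F^[k] (D.ι w) := fun w k => by
    induction k with
    | zero => rfl
    | succ k ih =>
      rw [Function.iterate_succ_apply', Function.iterate_succ_apply', ih, Function.comp_apply,
        oracleResolve_of_not_isQuery B (hq w k)]
  { F := D.F
    F_mem := D.F_mem
    ι := D.ι
    ι_mem := D.ι_mem
    Nu := D.Nu
    Nu_mem := D.Nu_mem
    s := D.s
    Nu_le := D.Nu_le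
    size_le := fun w k => by rw [horb]; exact D.size_le w k
    fsize_le := fun w k => by rw [horb, ← Function.iterate_succ_apply' D.F]; exact D.size_le w (k + 1)
    correct := fun w => by rw [horb]; exact D.correct w }

end Literature.Computability.Complexity

end
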